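import Literature.NumberTheory.LFunctions.UniformTwistedZeroFreeRegion
import HarnessLib

/-!
# `F'/F` near `σ = 1` for the uniform twisted datum (MV Theorem 11.4, crude abstract form)

Topic `Literature/NumberTheory/LFunctions`, continuing `UniformTwistedZeroFreeRegion.lean`
(`UniformTwistedZFRData`: Montgomery–Vaughan §11.1 with the conductor parameter `Q` allowed to
absorb the discriminant, i.e. `re_LSeries₀_le` with constant `K₀(log Q + log 4)` and the lower bound
for `|F|` only at the disc centres). Everything in this file is PROVED (theorems only).

This is the section `LogDerivBound` and the theorem `exists_logDeriv_bound_const` of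
`TwistedZeroFreeRegion.lean`, re-run for the uniform datum — the proofs are the same, the term `K₀`
of the crude bound `‖F'/F(s)‖ ≤ 1/(σ − 1) + K₀` becoming `K₀(log Q + log 4) ≤ K₀ ℒ`, which is where
it was absorbed anyway:

* `norm_logDeriv_le_of_one_lt_re` — `‖F'/F(s)‖ ≤ 1/(min(σ,2) − 1) + K₀(log Q + log 4)` (`σ > 1`);
* `sum_mult_le` — MV (11.11): the total multiplicity of the zeros in the Lemma-α disc at height
  `t` is `≤ (16/η)(16/η + K₀ + E) ℒ²`, `ℒ = log Q + log(|t| + 4)`;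
* `UniformTwistedZFRData.exists_logDeriv_bound_const` — **MV Theorem 11.4, crude form, uniformly
  in `Q`**: `∃ c > 0, C ≥ 0` (before the data) such that for every datum, `F(s) ≠ 0` and
  `‖F'/F(s)‖ ≤ C (log Q + log 4)³/d · log(|t| + 4)` for `σ ≥ 1 − c/(log Q + log(|t|+4))` and `s`
  at distance `≥ d` from the real zeros `a > 1 − 2c/(log Q + log 4)` (none unless `pole`). This is
  the input `M(λ + log(|t|+4))^p` of `LogRieszMeanConductor.lean` (`λ = log Q`), now available for
  the class group `L`-functions with `Q = |d_K|` (`ClassGroupLFunctionZeroFreeRegion.lean`).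

## References

* H. L. Montgomery, R. C. Vaughan, *Multiplicative Number Theory I. Classical Theory*, Cambridge
  Stud. Adv. Math. 97 (2007), §11.1, Theorem 11.4 (proof, pp. 277–278).
  [cite: MontgomeryVaughan2007, Theorem 11.4]
* J. Thorner, A. Zaman, *A unified and improved Chebotarev density theorem*, Algebra & Number
  Theory 13 (2019), Lemma 2.6, Theorem 3.1. [cite: ThornerZaman2019, Lemma 2.6]
-/

noncomputable section

open Complex Filter Topology Metric Set Finset
open scoped ComplexConjugate

namespace Literature.NumberTheory.LFunctions

namespace UniformTwistedZFRData

variable {η A Cg c₁ K₀ C₂ : ℝ} {pole : Bool} {Q : ℝ} {Λ₀ : ℕ → ℝ} {Λ₁ Λ₂ : ℕ → ℂ} {F : ℂ → ℂ}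

/-- Local notation for the package constant `E(η, A, C_g, c₁) = 8(2A + |log(32C_g/(c₁η))| + 1)/(η/4)`. -/
local notation3 "E[" η "," A "," Cg "," c₁ "]" =>
  (8 * (2 * (A : ℝ) + |Real.log ((Cg : ℝ) / ((c₁ : ℝ) * ((η : ℝ) / 32)))| + 1) / ((η : ℝ) / 4))

/-! ## `F'/F` near `σ = 1`, away from the exceptional zeros (MV Theorem 11.4, crude form) -/

section LogDerivBound

variable (h : UniformTwistedZFRData η A Cg c₁ K₀ C₂ pole Q Λ₀ Λ₁ Λ₂ F)
include h

/-- The crude bound to the right of `σ = 1`: `‖F'/F(s)‖ ≤ 1/(min(σ,2) − 1) + K₀(log Q + log 4)`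
for `σ > 1` (`|L(Λ₁, s)| ≤ Re L(Λ₀, min(σ,2))`). [cite: MontgomeryVaughan2007, Theorem 11.4 (proof, p. 277)] -/
theorem norm_logDeriv_le_of_one_lt_re (s : ℂ) (hs : 1 < s.re) :
    ‖deriv F s / F s‖ ≤ 1 / (min s.re 2 - 1) + K₀ * (Real.log Q + Real.log 4) := by
  set σ' : ℝ := min s.re 2 with hσ'
  have hσ'1 : 1 < σ' := lt_min hs (by norm_num)
  have hσ'2 : σ' ≤ 2 := min_le_right _ _
  have hσ's : σ' ≤ s.re := min_le_left _ _
  rw [h.logDeriv_eq s hs, norm_neg]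
  exact (TwistedZFR.norm_LSeries_le_of_norm_le h.norm_le₁ h.summable hσ'1 hσ's).trans
    (h.re_LSeries₀_le σ' hσ'1 hσ'2)

/-- **Total multiplicity of the zeros in the Lemma-α disc** (MV (11.11)): with the package at
height `t` and `s₁ = 1 + κ + it`, `κ = η/(16ℒ)`, `ℒ = log Q + log(|t| + 4)`:
`∑_{a ∈ S} m(a) ≤ (16/η)(16/η + K₀ + E) ℒ²`, because `Re ∑ m(a)/(s₁ − a) ≤ ‖F'/F(s₁)‖ + ‖ψ(s₁)‖ ≤
(16/η + K₀ + E)ℒ` and `Re 1/(s₁ − a) ≥ Re (s₁ − a) ≥ κ` for `|s₁ − a| ≤ 1`.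
[cite: MontgomeryVaughan2007, Theorem 11.4 (proof, eq. (11.11))] -/
theorem sum_mult_le {E : ℝ} (hE : 0 ≤ E) {t : ℝ} {S : Finset ℂ} {m : ℂ → ℕ} {ψ : ℂ → ℂ}
    (hS : ∀ a ∈ S, F a = 0 ∧ 0 < m a ∧ ‖a - (1 + η / 32 + t * I)‖ ≤ η / 4)
    (hψ : ∀ z ∈ ball (1 + η / 32 + t * I) (η / 4), F z ≠ 0 →
          ψ z = deriv F z / F z - ∑ a ∈ S, (m a : ℂ) / (z - a))
    (hψb : ∀ z ∈ closedBall (1 + η / 32 + t * I) (η / 16),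
          ‖ψ z‖ ≤ E * (Real.log Q + Real.log (|t| + 4))) :
    (∑ a ∈ S, (m a : ℝ)) ≤
      16 / η * (16 / η + K₀ + E) * (Real.log Q + Real.log (|t| + 4)) ^ 2 := by
  have hη := h.eta_pos
  have hη1 := h.eta_le_one
  have hK₀ := h.K₀_nonneg
  have hQ := h.one_le_Q
  set ℒ : ℝ := Real.log Q + Real.log (|t| + 4) with hℒ
  have hℒ1 : 1 ≤ ℒ := TwistedZFR.one_le_ell hQ t
  have hℒ0 : 0 < ℒ := by linarith
  set κ : ℝ := η / (16 * ℒ) with hκdef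
  have hκ : 0 < κ := by positivity
  have hκ1 : κ ≤ η / 16 := by
    rw [hκdef]; exact div_le_div_of_nonneg_left hη.le (by norm_num) (by nlinarith)
  obtain ⟨s₁, hs₁⟩ : ∃ s₁ : ℂ, s₁ = ((1 + κ : ℝ) : ℂ) + t * I := ⟨_, rfl⟩
  have hs₁re : s₁.re = 1 + κ := by simp [hs₁]
  have hs₁1 : 1 < s₁.re := by rw [hs₁re]; linarith
  set c : ℂ := 1 + η / 32 + t * I with hcdef
  have hs₁c : ‖s₁ - c‖ ≤ η / 16 := by
    have : s₁ - c = ((κ - η / 32 : ℝ) : ℂ) := by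
      simp only [hs₁, hcdef]; push_cast; ring
    rw [this, Complex.norm_real, Real.norm_eq_abs, abs_le]
    constructor <;> linarith
  have hs₁ball : s₁ ∈ ball c (η / 4) := mem_ball_iff_norm.2 (by linarith)
  have hs₁cl : s₁ ∈ closedBall c (η / 16) := mem_closedBall_iff_norm.2 hs₁c
  have hF₁ : F s₁ ≠ 0 := h.ne_zero s₁ hs₁1
  have hψ₁ := hψ s₁ hs₁ball hF₁
  -- `Re ∑ ≤ (16/η + K₀ + E) ℒ`
  have hbound : (∑ a ∈ S, (m a : ℂ) / (s₁ - a)).re ≤ (16 / η + K₀ + E) * ℒ := by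
    have hEq : ∑ a ∈ S, (m a : ℂ) / (s₁ - a) = deriv F s₁ / F s₁ - ψ s₁ := by
      rw [hψ₁]; ring
    rw [hEq, Complex.sub_re]
    have h1 : ‖deriv F s₁ / F s₁‖ ≤ 16 / η * ℒ + K₀ * (Real.log Q + Real.log 4) := by
      have := h.norm_logDeriv_le_of_one_lt_re s₁ hs₁1
      have hmin : min s₁.re 2 = 1 + κ := by rw [hs₁re]; exact min_eq_left (by linarith)
      rw [hmin, show 1 + κ - 1 = κ by ring, hκdef, one_div_div] at this
      convert this using 2; ring
    have h2 := hψb s₁ hs₁cl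
    have h3 := Complex.abs_re_le_norm (deriv F s₁ / F s₁)
    have h4 := Complex.abs_re_le_norm (ψ s₁)
    have hK₀ℒ : K₀ * (Real.log Q + Real.log 4) ≤ K₀ * ℒ :=
      mul_le_mul_of_nonneg_left (log_add_log_four_le Q t) hK₀
    rw [abs_le] at h3 h4
    nlinarith [h3.2, h4.1]
  -- each term: `m(a) κ ≤ Re (m(a)/(s₁ − a))`
  have hterm : ∀ a ∈ S, (m a : ℝ) * κ ≤ ((m a : ℂ) / (s₁ - a)).re := by
    intro a ha
    obtain ⟨hFa, -, hac⟩ := hS a ha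
    have hare : a.re ≤ 1 := h.re_le_one_of_zero hFa
    have hn : ‖s₁ - a‖ ≤ 1 := by
      calc ‖s₁ - a‖ = ‖(s₁ - c) + (c - a)‖ := by ring_nf
        _ ≤ ‖s₁ - c‖ + ‖c - a‖ := norm_add_le _ _
        _ ≤ η / 16 + η / 4 := by rw [norm_sub_rev c a]; exact add_le_add hs₁c hac
        _ ≤ 1 := by linarith
    have hre0 : κ ≤ (s₁ - a).re := by
      simp only [Complex.sub_re, hs₁re]; linarith
    have hinv := DirichletZFR.re_le_re_inv hn (by linarith)
    have hre : ((m a : ℂ) / (s₁ - a)).re = (m a : ℝ) * ((s₁ - a)⁻¹).re := by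
      rw [div_eq_mul_inv, show ((m a : ℕ) : ℂ) = ((m a : ℝ) : ℂ) by simp, Complex.re_ofReal_mul]
    rw [hre]
    exact mul_le_mul_of_nonneg_left (hre0.trans hinv) (Nat.cast_nonneg _)
  have hsum : (∑ a ∈ S, (m a : ℝ)) * κ ≤ (16 / η + K₀ + E) * ℒ := by
    rw [Finset.sum_mul]
    refine le_trans ?_ hbound
    rw [Complex.re_sum]
    exact Finset.sum_le_sum hterm
  rw [hκdef, ← le_div_iff₀ (by positivity)] at hsum
  refine hsum.trans (le_of_eq ?_)
  field_simp

end LogDerivBound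

set_option maxHeartbeats 1600000 in
/-- **`F'/F(s) ≪ (log Q + log 4)³/d · log(|t|+4)` near `σ = 1`, away from the exceptional zeros**
(crude form of MV Theorem 11.4, (11.5)/(11.8), abstract twisted version): for all numeric
parameters there are `c > 0`, `C ≥ 0` such that for EVERY datum `TwistedZFRData … pole Q Λ₀ Λ₁ Λ₂ F`,
every `s = σ + it` with `σ ≥ 1 − c/(log Q + log(|t| + 4))` and every `0 < d ≤ 1` with `|s − a| ≥ d`
for all real zeros `a` of `F` with `a > 1 − 2c/(log Q + log 4)` (there are none unless
`pole = true`, first clause), `F(s) ≠ 0` and `‖F'/F(s)‖ ≤ C ((log Q + log 4)³ / d) · log(|t| + 4)`.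
Proof as in `DirichletZFR.exists_norm_logDeriv_le_of_re_ge` (MV p. 278) with the radii `η/4`,
`η/16` and `s₁ = 1 + η/(16ℒ) + it`. [cite: MontgomeryVaughan2007, Theorem 11.4] -/
theorem exists_logDeriv_bound_const {η A Cg c₁ K₀ C₂ : ℝ} (hη : 0 < η) (hη1 : η ≤ 1) (hA : 0 ≤ A)
    (hK₀ : 0 ≤ K₀) (hC₂ : 0 ≤ C₂) :
    ∃ c : ℝ, 0 < c ∧ ∃ C : ℝ, 0 ≤ C ∧
      (∀ (pole : Bool) (Q : ℝ) (Λ₀ : ℕ → ℝ) (Λ₁ Λ₂ : ℕ → ℂ) (F : ℂ → ℂ),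
        UniformTwistedZFRData η A Cg c₁ K₀ C₂ pole Q Λ₀ Λ₁ Λ₂ F → ∀ ρ : ℂ, F ρ = 0 →
          1 - 2 * c / (Real.log Q + Real.log (|ρ.im| + 4)) < ρ.re → pole = true ∧ ρ.im = 0) ∧
      ∀ (pole : Bool) (Q : ℝ) (Λ₀ : ℕ → ℝ) (Λ₁ Λ₂ : ℕ → ℂ) (F : ℂ → ℂ),
        UniformTwistedZFRData η A Cg c₁ K₀ C₂ pole Q Λ₀ Λ₁ Λ₂ F →
        ∀ (s : ℂ) (d : ℝ), 0 < d → d ≤ 1 →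
          1 - c / (Real.log Q + Real.log (|s.im| + 4)) ≤ s.re →
          (∀ a : ℂ, F a = 0 → a.im = 0 →
            1 - 2 * c / (Real.log Q + Real.log 4) < a.re → d ≤ ‖s - a‖) →
          F s ≠ 0 ∧
            ‖deriv F s / F s‖ ≤
              C * ((Real.log Q + Real.log 4) ^ 3 / d) * Real.log (|s.im| + 4) := by
  obtain ⟨c₀, hc₀, hzf⟩ := exists_zeroFree_const (Cg := Cg) (c₁ := c₁) hη hA hK₀ hC₂
  obtain ⟨E, hEdef⟩ : ∃ E : ℝ, E = E[η, A, Cg, c₁] := ⟨_, rfl⟩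
  have hE : 0 ≤ E := by rw [hEdef]; positivity
  -- constants
  set c : ℝ := min (c₀ / 4) (η / 32) with hcdef
  have hc4 : c ≤ c₀ / 4 := min_le_left _ _
  have hcη : c ≤ η / 32 := min_le_right _ _
  have hcpos : 0 < c := lt_min (by positivity) (by positivity)
  clear_value c
  have hzf2 : ∀ (pole : Bool) (Q : ℝ) (Λ₀ : ℕ → ℝ) (Λ₁ Λ₂ : ℕ → ℂ) (F : ℂ → ℂ),
      UniformTwistedZFRData η A Cg c₁ K₀ C₂ pole Q Λ₀ Λ₁ Λ₂ F → ∀ ρ : ℂ, F ρ = 0 →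
      1 - 2 * c / (Real.log Q + Real.log (|ρ.im| + 4)) < ρ.re → pole = true ∧ ρ.im = 0 := by
    intro pole Q Λ₀ Λ₁ Λ₂ F h ρ hρ hre
    refine hzf pole Q Λ₀ Λ₁ Λ₂ F h ρ hρ (lt_of_le_of_lt ?_ hre)
    have hℒ := TwistedZFR.ell_pos h.one_le_Q ρ.im
    have : 2 * c / (Real.log Q + Real.log (|ρ.im| + 4)) ≤
        c₀ / (Real.log Q + Real.log (|ρ.im| + 4)) :=
      div_le_div_of_nonneg_right (by linarith) hℒ.le
    linarith
  set U : ℝ := 16 / η + K₀ + E with hU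
  have hU0 : 0 ≤ U := by rw [hU]; positivity
  set Kc : ℝ := 2 * (η / (16 * c) + 2) with hKc
  have hKc0 : 0 ≤ Kc := by rw [hKc]; positivity
  clear_value Kc
  have hKcU : 0 ≤ Kc * U := mul_nonneg hKc0 hU0
  have h20 : 0 ≤ 1 + 20 / η := by positivity
  set C : ℝ := (E + U + Kc * U + 16 / η + K₀) + 25 / η * U * (1 + 20 / η) + 1 with hCdef
  have hCpos : 0 ≤ C := by rw [hCdef]; positivity
  clear_value C
  refine ⟨c, hcpos, C, hCpos, hzf2, fun pole Q Λ₀ Λ₁ Λ₂ F h s d hd hd1 hregion hexc ↦ ?_⟩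
  have hQ := h.one_le_Q
  have hpack := h.exists_package
  rw [← hEdef] at hpack
  obtain ⟨σ, hσdef⟩ : ∃ σ : ℝ, s.re = σ := ⟨_, rfl⟩
  obtain ⟨t, htdef⟩ : ∃ t : ℝ, s.im = t := ⟨_, rfl⟩
  have hs : s = σ + t * I := by
    rw [← hσdef, ← htdef]; exact (Complex.re_add_im s).symm.trans (by simp [mul_comm])
  rw [hσdef, htdef] at hregion
  rw [htdef]
  have hlogQ : 0 ≤ Real.log Q := Real.log_nonneg hQ
  have hlog4 : 1 ≤ Real.log 4 := by
    have := ClassicalZFRData.one_le_log_tau 0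
    rwa [abs_zero, zero_add] at this
  have hlogτ : 1 ≤ Real.log (|t| + 4) := ClassicalZFRData.one_le_log_tau t
  have hlog4τ : Real.log 4 ≤ Real.log (|t| + 4) :=
    Real.log_le_log (by norm_num) (by linarith [abs_nonneg t])
  have hell5 : |t| ≤ 1 → Real.log Q + Real.log (|t| + 4) ≤
      5 / 4 * (Real.log Q + Real.log 4) := fun ht ↦ by
    have := TwistedZFR.ell_le_of_abs_le hQ (t := 0) (t' := t) (by rw [abs_zero]; linarith)
    rwa [abs_zero, zero_add] at this
  set ℒ : ℝ := Real.log Q + Real.log (|t| + 4) with hℒ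
  set ℒ₀ : ℝ := Real.log Q + Real.log 4 with hℒ₀
  have hℒ1 : 1 ≤ ℒ := TwistedZFR.one_le_ell hQ t
  have hℒ0 : 0 < ℒ := by linarith
  have hℒ₀1 : 1 ≤ ℒ₀ := by rw [hℒ₀]; linarith
  have hℒ₀0 : 0 < ℒ₀ := by linarith
  have hℒ₀ℒ : ℒ₀ ≤ ℒ := by rw [hℒ₀, hℒ]; linarith
  have hℒprod : ℒ ≤ ℒ₀ * Real.log (|t| + 4) := by
    rw [hℒ, hℒ₀, add_mul]; nlinarith
  clear_value ℒ ℒ₀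
  have hcℒ : c / ℒ ≤ c := div_le_self hcpos.le hℒ1
  -- every zero `a` with `Re a > 1 − 2c/ℒ` and `|Im a| ≤ |t| + 1` is real and far from `s`
  have hreal : ∀ a : ℂ, F a = 0 → |a.im| ≤ |t| + 1 → 1 - 2 * c / ℒ < a.re →
      a.im = 0 ∧ d ≤ ‖s - a‖ := by
    intro a hFa haim hare
    have hℒa := TwistedZFR.ell_le_of_abs_le hQ haim
    rw [← hℒ] at hℒa
    have hℒa0 : 0 < Real.log Q + Real.log (|a.im| + 4) := TwistedZFR.ell_pos hQ a.im
    have h1 : c₀ / ℒ * (4 / 5) ≤ c₀ / (Real.log Q + Real.log (|a.im| + 4)) := by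
      rw [div_mul_eq_mul_div, div_le_div_iff₀ (by positivity) hℒa0]
      nlinarith
    have h2 : 2 * c / ℒ ≤ c₀ / ℒ * (4 / 5) := by
      rw [div_mul_eq_mul_div, div_le_div_iff₀ hℒ0 (by positivity)]
      have : 2 * c ≤ c₀ * 4 / 5 := by linarith
      nlinarith
    have hzone : 1 - c₀ / (Real.log Q + Real.log (|a.im| + 4)) < a.re := by linarith
    obtain ⟨-, him⟩ := hzf pole Q Λ₀ Λ₁ Λ₂ F h a hFa hzone
    have h3 : 2 * c / ℒ ≤ 2 * c / ℒ₀ :=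
      div_le_div_of_nonneg_left (by positivity) hℒ₀0 hℒ₀ℒ
    exact ⟨him, hexc a hFa him (by linarith)⟩
  -- `F(s) ≠ 0`
  have hFs : F s ≠ 0 := by
    intro hFs
    have him : |s.im| ≤ |t| + 1 := by rw [htdef]; linarith
    have hre : 1 - 2 * c / ℒ < s.re := by
      have h1 : 0 < c / ℒ := by positivity
      have h2 : 2 * c / ℒ = 2 * (c / ℒ) := by ring
      rw [hσdef]; linarith
    obtain ⟨-, hds⟩ := hreal _ hFs him hre
    rw [sub_self, norm_zero] at hds
    linarith
  refine ⟨hFs, ?_⟩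
  have hℒ₀3 : ℒ₀ ≤ ℒ₀ ^ 3 / d := by
    rw [le_div_iff₀ hd]
    calc ℒ₀ * d ≤ ℒ₀ * 1 := mul_le_mul_of_nonneg_left hd1 hℒ₀0.le
      _ ≤ ℒ₀ ^ 3 := by nlinarith [one_le_pow₀ (n := 2) hℒ₀1]
  have hℒ₀3d : 0 ≤ ℒ₀ ^ 3 / d := div_nonneg (pow_nonneg hℒ₀0.le 3) hd.le
  -- a bound `B ℒ ≤ B ℒ₀³/d · log(|t|+4)` for non-negative `B`
  have hscale : ∀ B : ℝ, 0 ≤ B → B * ℒ ≤ B * (ℒ₀ ^ 3 / d) * Real.log (|t| + 4) := by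
    intro B hB
    calc B * ℒ ≤ B * (ℒ₀ * Real.log (|t| + 4)) := mul_le_mul_of_nonneg_left hℒprod hB
      _ ≤ B * (ℒ₀ ^ 3 / d * Real.log (|t| + 4)) :=
          mul_le_mul_of_nonneg_left (mul_le_mul_of_nonneg_right hℒ₀3 (by linarith only [hlogτ])) hB
      _ = B * (ℒ₀ ^ 3 / d) * Real.log (|t| + 4) := by ring
  have hK₀ℒ : K₀ * ℒ₀ ≤ K₀ * ℒ := mul_le_mul_of_nonneg_left hℒ₀ℒ hK₀
  -- `κ = η/(16ℒ)`, `σ₁ = 1 + κ`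
  set κ : ℝ := η / (16 * ℒ) with hκdef
  have hκ : 0 < κ := by positivity
  have hκ1 : κ ≤ η / 16 := by
    rw [hκdef]; exact div_le_div_of_nonneg_left hη.le (by norm_num) (by nlinarith)
  have hκinv : 1 / κ = 16 / η * ℒ := by rw [hκdef, one_div_div]; ring
  set σ₁ : ℝ := 1 + κ with hσ₁
  have hσ₁1 : 1 < σ₁ := by rw [hσ₁]; linarith
  rcases le_or_gt σ₁ σ with hbig | hsmallσ
  · -- the easy case `σ ≥ σ₁`: `‖F'/F‖ ≤ 16ℒ/η + K₀`
    have h3 : 1 / (min σ 2 - 1) ≤ 16 / η * ℒ := by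
      have hmin : κ ≤ min σ 2 - 1 := by
        rw [le_sub_iff_add_le]
        exact le_min (by rw [hσ₁] at hbig; linarith) (by linarith)
      calc 1 / (min σ 2 - 1) ≤ 1 / κ := one_div_le_one_div_of_le hκ hmin
        _ = 16 / η * ℒ := hκinv
    have hbound : 1 / (min σ 2 - 1) + K₀ * ℒ₀ ≤ C * (ℒ₀ ^ 3 / d) * Real.log (|t| + 4) := by
      have h4 : 1 / (min σ 2 - 1) + K₀ * ℒ₀ ≤ (16 / η + K₀) * ℒ := by linarith
      have h5 := hscale (16 / η + K₀) (by positivity)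
      have h6 : (16 / η + K₀) * (ℒ₀ ^ 3 / d) * Real.log (|t| + 4) ≤
          C * (ℒ₀ ^ 3 / d) * Real.log (|t| + 4) := by
        refine mul_le_mul_of_nonneg_right (mul_le_mul_of_nonneg_right ?_ hℒ₀3d) (by linarith)
        rw [hCdef]
        have : 0 ≤ 25 / η * U * (1 + 20 / η) := by positivity
        linarith
      linarith
    have h1 : 1 < s.re := by rw [hσdef]; linarith
    have h2 := h.norm_logDeriv_le_of_one_lt_re s h1
    rw [hσdef, ← hℒ₀] at h2
    exact h2.trans hbound
  -- pure real-variable facts for the main case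
  have hKc_ge : (κ + c / ℒ) / κ * ((κ + c / ℒ) / (c / ℒ) + 1) ≤ Kc := by
    have e1 : (κ + c / ℒ) / κ = 1 + 16 * c / η := by rw [hκdef]; field_simp
    have e2 : (κ + c / ℒ) / (c / ℒ) = η / (16 * c) + 1 := by rw [hκdef]; field_simp
    rw [e1, e2]
    have h1 : 1 + 16 * c / η ≤ 2 := by
      have : 16 * c / η ≤ 1 / 2 := by
        rw [div_le_div_iff₀ hη (by norm_num)]; linarith
      linarith
    have h0 : 0 ≤ η / (16 * c) + 1 + 1 := by positivity
    calc (1 + 16 * c / η) * (η / (16 * c) + 1 + 1) ≤ 2 * (η / (16 * c) + 1 + 1) :=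
          mul_le_mul_of_nonneg_right h1 h0
      _ = Kc := by rw [hKc]; ring
  have h2c : 2 * c / ℒ = 2 * (c / ℒ) := by ring
  have hposA : 0 ≤ E + U + Kc * U := by linarith only [hE, hU0, hKcU]
  have hposd : 0 < 1 / d := by positivity
  have h25 : 0 ≤ 25 / η * U := by positivity
  have hX0 : 0 ≤ 25 / η * U * ℒ₀ ^ 2 * (1 / d + 20 / η * ℒ₀) := by positivity
  have hB : 25 / η * U * ℒ₀ ^ 2 * (1 / d + 20 / η * ℒ₀) ≤
      (25 / η * U * (1 + 20 / η)) * (ℒ₀ ^ 3 / d) * Real.log (|t| + 4) := by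
    have hd' : 1 ≤ 1 / d := by
      rw [le_div_iff₀ hd]; linarith only [hd1]
    have hℒ₀cube : ℒ₀ ^ 2 ≤ ℒ₀ ^ 3 := pow_le_pow_right₀ hℒ₀1 (by norm_num)
    have hℒ₀3nn : 0 ≤ ℒ₀ ^ 3 := pow_nonneg hℒ₀0.le 3
    have h2 : ℒ₀ ^ 2 * (1 / d) ≤ ℒ₀ ^ 3 * (1 / d) := mul_le_mul_of_nonneg_right hℒ₀cube hposd.le
    have h3 : ℒ₀ ^ 3 * 1 ≤ ℒ₀ ^ 3 * (1 / d) := mul_le_mul_of_nonneg_left hd' hℒ₀3nn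
    have h20η : 0 ≤ 20 / η := by positivity
    have h1 : ℒ₀ ^ 2 * (1 / d + 20 / η * ℒ₀) ≤ (1 + 20 / η) * (ℒ₀ ^ 3 / d) := by
      have e1 : ℒ₀ ^ 2 * (1 / d + 20 / η * ℒ₀) = ℒ₀ ^ 2 * (1 / d) + 20 / η * (ℒ₀ ^ 3 * 1) := by ring
      have e2 : (1 + 20 / η) * (ℒ₀ ^ 3 / d) = ℒ₀ ^ 3 * (1 / d) + 20 / η * (ℒ₀ ^ 3 * (1 / d)) := by
        ring
      rw [e1, e2]
      have := mul_le_mul_of_nonneg_left h3 h20η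
      linarith only [h2, this]
    have h13U' : 0 ≤ (25 / η * U * (1 + 20 / η)) * (ℒ₀ ^ 3 / d) := by positivity
    have e3 : 25 / η * U * ℒ₀ ^ 2 * (1 / d + 20 / η * ℒ₀) =
        25 / η * U * (ℒ₀ ^ 2 * (1 / d + 20 / η * ℒ₀)) := by ring
    have e4 : 25 / η * U * ((1 + 20 / η) * (ℒ₀ ^ 3 / d)) =
        (25 / η * U * (1 + 20 / η)) * (ℒ₀ ^ 3 / d) * 1 := by ring
    have h5 : 25 / η * U * (ℒ₀ ^ 2 * (1 / d + 20 / η * ℒ₀)) ≤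
        25 / η * U * ((1 + 20 / η) * (ℒ₀ ^ 3 / d)) := mul_le_mul_of_nonneg_left h1 h25
    have h6 : (25 / η * U * (1 + 20 / η)) * (ℒ₀ ^ 3 / d) * 1 ≤
        (25 / η * U * (1 + 20 / η)) * (ℒ₀ ^ 3 / d) * Real.log (|t| + 4) :=
      mul_le_mul_of_nonneg_left hlogτ h13U'
    rw [e3]
    rw [e4] at h5
    exact h5.trans h6
  have hA' := hscale (E + U + Kc * U) hposA
  have hC : (E + U + Kc * U) * (ℒ₀ ^ 3 / d) * Real.log (|t| + 4) +
      (25 / η * U * (1 + 20 / η)) * (ℒ₀ ^ 3 / d) * Real.log (|t| + 4) ≤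
        C * (ℒ₀ ^ 3 / d) * Real.log (|t| + 4) := by
    rw [← add_mul, ← add_mul]
    have hlogτ0 : 0 ≤ Real.log (|t| + 4) := by linarith only [hlogτ]
    refine mul_le_mul_of_nonneg_right (mul_le_mul_of_nonneg_right ?_ hℒ₀3d) hlogτ0
    rw [hCdef]
    have : 0 ≤ 16 / η := by positivity
    linarith only [hK₀, this]
  have htarget : (E + U + Kc * U) * ℒ + 25 / η * U * ℒ₀ ^ 2 * (1 / d + 20 / η * ℒ₀) ≤
      C * (ℒ₀ ^ 3 / d) * Real.log (|t| + 4) := by linarith only [hA', hB, hC]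
  have hnearScale : |t| ≤ 1 →
      (16 / η * U * ℒ ^ 2) * (1 / d + 16 / η * ℒ) ≤
        25 / η * U * ℒ₀ ^ 2 * (1 / d + 20 / η * ℒ₀) := by
    intro ht
    have hℒℒ₀ : ℒ ≤ 5 / 4 * ℒ₀ := hell5 ht
    have h16 : 0 ≤ 16 / η := by positivity
    calc (16 / η * U * ℒ ^ 2) * (1 / d + 16 / η * ℒ)
        ≤ (16 / η * U * (5 / 4 * ℒ₀) ^ 2) * (1 / d + 16 / η * (5 / 4 * ℒ₀)) := by
          have h1 : ℒ ^ 2 ≤ (5 / 4 * ℒ₀) ^ 2 := pow_le_pow_left₀ hℒ0.le hℒℒ₀ 2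
          have h2 : 1 / d + 16 / η * ℒ ≤ 1 / d + 16 / η * (5 / 4 * ℒ₀) := by
            have := mul_le_mul_of_nonneg_left hℒℒ₀ h16
            linarith only [this]
          have h3 : 0 ≤ 1 / d + 16 / η * ℒ := by positivity
          have h4 : 0 ≤ 16 / η * U := by positivity
          have h5 : 0 ≤ 16 / η * U * (5 / 4 * ℒ₀) ^ 2 := mul_nonneg h4 (sq_nonneg _)
          exact mul_le_mul (mul_le_mul_of_nonneg_left h1 h4) h2 h3 h5
      _ = 25 / η * U * ℒ₀ ^ 2 * (1 / d + 20 / η * ℒ₀) := by ring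
  -- the main case `1 − c/ℒ ≤ σ < σ₁`: `s` and `s₁` lie in the small disc at height `t`
  obtain ⟨S, m, ψ, hS, hS', hψ, hψb⟩ := hpack t
  have hmult := h.sum_mult_le hE hS hψ hψb
  rw [← hℒ] at hmult
  obtain ⟨cc, hccdef⟩ : ∃ cc : ℂ, cc = 1 + η / 32 + t * I := ⟨_, rfl⟩
  rw [← hccdef] at hS hS' hψ hψb
  have hccim : cc.im = t := by rw [hccdef]; simp
  have hσlow : 1 - η / 32 ≤ σ := by
    have h1 : c / ℒ ≤ η / 32 := hcℒ.trans hcη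
    linarith only [h1, hregion]
  have hsc : ‖s - cc‖ ≤ η / 16 := by
    have : s - cc = ((σ - (1 + η / 32) : ℝ) : ℂ) := by rw [hs, hccdef]; push_cast; ring
    rw [this, Complex.norm_real, Real.norm_eq_abs]
    refine abs_le.2 ⟨by linarith only [hσlow, hη], ?_⟩
    rw [hσ₁] at hsmallσ
    linarith only [hsmallσ, hκ1, hη]
  have hsball : s ∈ ball cc (η / 4) :=
    mem_ball_iff_norm.2 (by linarith only [hsc, hη])
  have hscl : s ∈ closedBall cc (η / 16) := mem_closedBall_iff_norm.2 hsc
  have hψs := hψ _ hsball hFs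
  -- the auxiliary point `s₁`
  obtain ⟨s₁, hs₁⟩ : ∃ s₁ : ℂ, s₁ = (σ₁ : ℂ) + t * I := ⟨_, rfl⟩
  have hs₁re : s₁.re = σ₁ := by simp [hs₁]
  have hs₁im : s₁.im = t := by simp [hs₁]
  have hs₁1 : 1 < s₁.re := by rw [hs₁re]; exact hσ₁1
  have hs₁c : ‖s₁ - cc‖ ≤ η / 16 := by
    have : s₁ - cc = ((σ₁ - (1 + η / 32) : ℝ) : ℂ) := by
      simp only [hs₁, hccdef]; push_cast; ring
    rw [this, Complex.norm_real, Real.norm_eq_abs, hσ₁]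
    exact abs_le.2 ⟨by linarith only [hκ, hη], by linarith only [hκ1, hη]⟩
  have hs₁ball : s₁ ∈ ball cc (η / 4) := mem_ball_iff_norm.2 (by linarith only [hs₁c, hη])
  have hs₁cl : s₁ ∈ closedBall cc (η / 16) := mem_closedBall_iff_norm.2 hs₁c
  have hF₁ : F s₁ ≠ 0 := h.ne_zero s₁ hs₁1
  have hψ₁ := hψ s₁ hs₁ball hF₁
  -- light facts about the zeros in `S`
  have hSre : ∀ a ∈ S, a.re ≤ 1 := fun a ha ↦ h.re_le_one_of_zero (hS a ha).1
  have hSre₁ : ∀ a ∈ S, κ ≤ (s₁ - a).re := by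
    intro a ha
    rw [Complex.sub_re, hs₁re, hσ₁]
    have := hSre a ha
    linarith only [this]
  have hSim : ∀ a ∈ S, |a.im| ≤ |t| + 1 ∧ |a.im - t| ≤ η / 4 := by
    intro a ha
    have h1 : |(a - cc).im| ≤ ‖a - cc‖ := Complex.abs_im_le_norm _
    have h2 : (a - cc).im = a.im - t := by rw [Complex.sub_im, hccim]
    rw [h2] at h1
    have h3 := (hS a ha).2.2
    have h4 := abs_sub_abs_le_abs_sub a.im t
    have h5 : |a.im - t| ≤ η / 4 := h1.trans h3
    refine ⟨?_, h5⟩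
    linarith only [h4, h5, hη1]
  have hterm_re : ∀ a ∈ S, ((m a : ℂ) / (s₁ - a)).re = (m a : ℝ) * ((s₁ - a)⁻¹).re := by
    intro a _
    rw [div_eq_mul_inv, show ((m a : ℕ) : ℂ) = ((m a : ℝ) : ℂ) by simp, Complex.re_ofReal_mul]
  have hinv_nn : ∀ a ∈ S, 0 ≤ ((s₁ - a)⁻¹).re := by
    intro a ha
    rw [Complex.inv_re]
    exact div_nonneg (hκ.le.trans (hSre₁ a ha)) (Complex.normSq_nonneg _)
  have hterm_nn : ∀ a ∈ S, 0 ≤ (m a : ℝ) * ((s₁ - a)⁻¹).re := fun a ha ↦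
    mul_nonneg (Nat.cast_nonneg _) (hinv_nn a ha)
  have hsumre_eq : (∑ a ∈ S, (m a : ℂ) / (s₁ - a)).re =
      ∑ a ∈ S, (m a : ℝ) * ((s₁ - a)⁻¹).re := by
    rw [Complex.re_sum]; exact Finset.sum_congr rfl hterm_re
  -- split `S` into far and near zeros
  classical
  obtain ⟨Sfar, hSfar⟩ : ∃ Sfar : Finset ℂ, Sfar = S.filter (fun a ↦ a.re ≤ 1 - 2 * c / ℒ) :=
    ⟨_, rfl⟩
  obtain ⟨Snear, hSnear⟩ :
      ∃ Snear : Finset ℂ, Snear = S.filter (fun a ↦ ¬ a.re ≤ 1 - 2 * c / ℒ) := ⟨_, rfl⟩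
  -- the far zeros: `‖1/(s−a) − 1/(s₁−a)‖ ≤ Kc · Re 1/(s₁ − a)`
  have hfar : ∀ a ∈ Sfar, ‖(s - a)⁻¹ - (s₁ - a)⁻¹‖ ≤ Kc * ((s₁ - a)⁻¹).re := by
    intro a ha
    rw [hSfar, Finset.mem_filter] at ha
    obtain ⟨haS, hare⟩ := ha
    have hw : s₁.re - s.re ≤ κ + c / ℒ := by
      rw [hs₁re, hσdef, hσ₁]; linarith only [hregion]
    have hdd : c / ℒ ≤ s.re - a.re := by
      rw [hσdef]; linarith only [hare, hregion, h2c]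
    have hκκ : κ ≤ s₁.re - a.re := by
      have := hSre₁ a haS; simpa only [Complex.sub_re] using this
    have hσσ₁ : s.re ≤ s₁.re := by rw [hσdef, hs₁re]; exact hsmallσ.le
    have h' := ClassicalZFRData.norm_inv_sub_inv_le (s := s) (s₁ := s₁) (a := a)
      (w := κ + c / ℒ) (d := c / ℒ) (κ := κ) (div_pos hcpos hℒ0) hκ
      (by rw [htdef, hs₁im]) hσσ₁ hw hdd hκκ
    exact h'.trans (mul_le_mul_of_nonneg_right hKc_ge (hinv_nn a haS))
  -- the near zeros are real, at distance `≥ d` from `s`, and force `|t| ≤ 1`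
  have hnear : ∀ a ∈ Snear, a.im = 0 ∧ d ≤ ‖s - a‖ ∧ |t| ≤ 1 := by
    intro a ha
    rw [hSnear, Finset.mem_filter] at ha
    obtain ⟨haS, hare⟩ := ha
    obtain ⟨him, hds⟩ := hreal a (hS a haS).1 (hSim a haS).1 (not_le.1 hare)
    refine ⟨him, hds, ?_⟩
    have := (hSim a haS).2
    rw [him, zero_sub, abs_neg] at this
    linarith only [this, hη1]
  have hnear_bd : ∀ a ∈ Snear, ‖(s - a)⁻¹ - (s₁ - a)⁻¹‖ ≤ 1 / d + 16 / η * ℒ := by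
    intro a ha
    obtain ⟨-, hds, -⟩ := hnear a ha
    have haS : a ∈ S := (Finset.mem_filter.1 (by rw [hSnear] at ha; exact ha)).1
    have h1 : ‖(s - a)⁻¹‖ ≤ 1 / d := by
      rw [norm_inv, one_div]
      exact inv_anti₀ hd hds
    have h2 : ‖(s₁ - a)⁻¹‖ ≤ 16 / η * ℒ := by
      rw [norm_inv]
      have hre : κ ≤ ‖s₁ - a‖ := (hSre₁ a haS).trans (Complex.re_le_norm _)
      calc ‖s₁ - a‖⁻¹ ≤ κ⁻¹ := inv_anti₀ hκ hre
        _ = 16 / η * ℒ := by rw [← one_div, hκinv]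
    exact (norm_sub_le _ _).trans (add_le_add h1 h2)
  -- (1) `‖∑ m(a)/(s₁ − a)‖ ≤ Uℒ`
  have hL'₁ : ‖deriv F s₁ / F s₁‖ ≤ 16 / η * ℒ + K₀ * ℒ₀ := by
    have := h.norm_logDeriv_le_of_one_lt_re s₁ hs₁1
    have hσ₁le2 : σ₁ ≤ 2 := by rw [hσ₁]; linarith only [hκ1, hη1]
    have hmin : min s₁.re 2 = σ₁ := by rw [hs₁re]; exact min_eq_left hσ₁le2
    rw [hmin, hσ₁, show 1 + κ - 1 = κ by ring, hκinv, ← hℒ₀] at this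
    exact this
  have hsum₁eq : ∑ a ∈ S, (m a : ℂ) / (s₁ - a) = deriv F s₁ / F s₁ - ψ s₁ := by
    rw [hψ₁]; ring
  have hsum₁ : ‖∑ a ∈ S, (m a : ℂ) / (s₁ - a)‖ ≤ U * ℒ := by
    rw [hsum₁eq]
    have h1 := norm_sub_le (deriv F s₁ / F s₁) (ψ s₁)
    have h2 := hψb s₁ hs₁cl
    rw [← hℒ] at h2
    have h3 : (16 / η * ℒ + K₀ * ℒ₀) + E * ℒ ≤ U * ℒ := by rw [hU]; linear_combination hK₀ℒ
    linarith only [h1, hL'₁, h2, h3]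
  have hsum₁re : ∑ a ∈ S, (m a : ℝ) * ((s₁ - a)⁻¹).re ≤ U * ℒ := by
    rw [← hsumre_eq]; exact (Complex.re_le_norm _).trans hsum₁
  -- (2) the near zeros, via the total multiplicity
  have hnear_sum : ∑ a ∈ Snear, (m a : ℝ) * ‖(s - a)⁻¹ - (s₁ - a)⁻¹‖ ≤
      25 / η * U * ℒ₀ ^ 2 * (1 / d + 20 / η * ℒ₀) := by
    by_cases hne : Snear = ∅
    · rw [hne, Finset.sum_empty]; exact hX0
    · obtain ⟨a₀, ha₀⟩ := Finset.nonempty_iff_ne_empty.2 hne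
      obtain ⟨-, -, ht⟩ := hnear a₀ ha₀
      have hnd : 0 ≤ 1 / d + 16 / η * ℒ := by positivity
      calc ∑ a ∈ Snear, (m a : ℝ) * ‖(s - a)⁻¹ - (s₁ - a)⁻¹‖
          ≤ ∑ a ∈ Snear, (m a : ℝ) * (1 / d + 16 / η * ℒ) :=
            Finset.sum_le_sum fun a ha ↦
              mul_le_mul_of_nonneg_left (hnear_bd a ha) (Nat.cast_nonneg _)
        _ = (∑ a ∈ Snear, (m a : ℝ)) * (1 / d + 16 / η * ℒ) := (Finset.sum_mul _ _ _).symm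
        _ ≤ (∑ a ∈ S, (m a : ℝ)) * (1 / d + 16 / η * ℒ) := by
            refine mul_le_mul_of_nonneg_right ?_ hnd
            exact Finset.sum_le_sum_of_subset_of_nonneg
              (by rw [hSnear]; exact Finset.filter_subset _ _) (fun a _ _ ↦ Nat.cast_nonneg _)
        _ ≤ (16 / η * U * ℒ ^ 2) * (1 / d + 16 / η * ℒ) := by
            refine mul_le_mul_of_nonneg_right ?_ hnd
            rw [hU]
            convert hmult using 1
        _ ≤ 25 / η * U * ℒ₀ ^ 2 * (1 / d + 20 / η * ℒ₀) := hnearScale ht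
  -- (3) the far sum: `≤ Kc · U ℒ`
  have hfar_sum : ∑ a ∈ Sfar, (m a : ℝ) * ‖(s - a)⁻¹ - (s₁ - a)⁻¹‖ ≤ Kc * (U * ℒ) := by
    calc ∑ a ∈ Sfar, (m a : ℝ) * ‖(s - a)⁻¹ - (s₁ - a)⁻¹‖
        ≤ ∑ a ∈ Sfar, (m a : ℝ) * (Kc * ((s₁ - a)⁻¹).re) :=
          Finset.sum_le_sum fun a ha ↦ mul_le_mul_of_nonneg_left (hfar a ha) (Nat.cast_nonneg _)
      _ = Kc * ∑ a ∈ Sfar, (m a : ℝ) * ((s₁ - a)⁻¹).re := by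
          rw [Finset.mul_sum]; exact Finset.sum_congr rfl fun a _ ↦ by ring
      _ ≤ Kc * ∑ a ∈ S, (m a : ℝ) * ((s₁ - a)⁻¹).re := by
          refine mul_le_mul_of_nonneg_left ?_ hKc0
          exact Finset.sum_le_sum_of_subset_of_nonneg
            (by rw [hSfar]; exact Finset.filter_subset _ _) (fun a ha _ ↦ hterm_nn a ha)
      _ ≤ Kc * (U * ℒ) := mul_le_mul_of_nonneg_left hsum₁re hKc0
  -- (4) assemble
  have hsplit : ∑ a ∈ S, (m a : ℂ) / (s - a) =
      ∑ a ∈ S, (m a : ℂ) * ((s - a)⁻¹ - (s₁ - a)⁻¹) + ∑ a ∈ S, (m a : ℂ) / (s₁ - a) := by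
    rw [← Finset.sum_add_distrib]
    exact Finset.sum_congr rfl fun a _ ↦ by ring
  have hdiff_sum : ‖∑ a ∈ S, (m a : ℂ) * ((s - a)⁻¹ - (s₁ - a)⁻¹)‖ ≤
      Kc * (U * ℒ) + 25 / η * U * ℒ₀ ^ 2 * (1 / d + 20 / η * ℒ₀) := by
    calc ‖∑ a ∈ S, (m a : ℂ) * ((s - a)⁻¹ - (s₁ - a)⁻¹)‖
        ≤ ∑ a ∈ S, ‖(m a : ℂ) * ((s - a)⁻¹ - (s₁ - a)⁻¹)‖ := norm_sum_le _ _
      _ = ∑ a ∈ S, (m a : ℝ) * ‖(s - a)⁻¹ - (s₁ - a)⁻¹‖ :=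
          Finset.sum_congr rfl fun a _ ↦ by rw [norm_mul, Complex.norm_natCast]
      _ = ∑ a ∈ Sfar, (m a : ℝ) * ‖(s - a)⁻¹ - (s₁ - a)⁻¹‖ +
            ∑ a ∈ Snear, (m a : ℝ) * ‖(s - a)⁻¹ - (s₁ - a)⁻¹‖ := by
          rw [hSfar, hSnear]
          exact (Finset.sum_filter_add_sum_filter_not S _ _).symm
      _ ≤ Kc * (U * ℒ) + 25 / η * U * ℒ₀ ^ 2 * (1 / d + 20 / η * ℒ₀) :=
          add_le_add hfar_sum hnear_sum
  have hEq : deriv F s / F s = ψ s + ∑ a ∈ S, (m a : ℂ) / (s - a) := by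
    rw [hψs]; ring
  have hψs_b := hψb s hscl
  rw [← hℒ] at hψs_b
  have hn1 := norm_add_le (ψ s)
    (∑ a ∈ S, (m a : ℂ) * ((s - a)⁻¹ - (s₁ - a)⁻¹) + ∑ a ∈ S, (m a : ℂ) / (s₁ - a))
  have hn2 := norm_add_le (∑ a ∈ S, (m a : ℂ) * ((s - a)⁻¹ - (s₁ - a)⁻¹))
    (∑ a ∈ S, (m a : ℂ) / (s₁ - a))
  rw [hEq, hsplit]
  have hfinalineq : E * ℒ + ((Kc * (U * ℒ) + 25 / η * U * ℒ₀ ^ 2 * (1 / d + 20 / η * ℒ₀)) + U * ℒ) =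
      (E + U + Kc * U) * ℒ + 25 / η * U * ℒ₀ ^ 2 * (1 / d + 20 / η * ℒ₀) := by ring
  linarith only [hn1, hn2, hψs_b, hdiff_sum, hsum₁, hfinalineq, htarget]

end UniformTwistedZFRData

end Literature.NumberTheory.LFunctions
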